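import Summits.CriticalPhenomena.PercolationContinuityZ3.Theorems.PercNearOneGluingNoHeavyLowerTailQ44SingleSourceLawAllN
import Summits.CriticalPhenomena.PercolationContinuityZ3.Theorems.PercNearOneGluingNoHeavyLowerTailFourPointExchangeB
import Literature.Probability.LatticeModels.StrongHarrisKleitman
import HarnessLib

/-!
# The port row `R_cy` of the three-port transfer for Conjecture W (row `Q44`): a new four-point inequality, all `n`

Support file for crux `stmt-CriticalPhenomena-4575` (master-family programme; Conjecture W = `TwoCopyMono.GoodKernel kerQ44`, open for
all `n`), seat `prim-l12-p6` gen 27; memo `run/shared/lean/prim/prim-l12/FROM-prim-l12-p6-g27-PORT-TRANSFER.md` §2.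

THE THREE-PORT TRANSFER (memo §1, tree `…Q44PortTransfer`): for `G = K ⊕_{b,c,y} R` (K = the side of `a`) Conjecture W for `G` is a quadratic form in
the three-point law of `(b,c,y)` in `R` whose coefficients are two-copy quantities of `K`, and `W(K ⊕ R) ≥ 0` for all `R` iff eight inequalities hold
for `K`; all eight are NECESSARY consequences of Conjecture W (limits over SK3-tight test graphs).  Two of them are theorems outright: `R_x`
(`…Q44PortRowX`, Harris) and — THIS FILE — **`R_cy`**, in the cells `cᵢ = FourPointAtoms.cell w a b c y i` of `(a,b,c,y)`:
`R_cy :  (c₅+c₆)(c₁+2c₂+c₃+c₇) + c₂c₁₃ ≤ 2c₀(c₄+c₈+c₉+c₁₀+c₁₁+c₁₂+c₁₄) + c₀c₁₃`.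
PROOF = the exact degree-2 certificate found by LP (kit j212020): `R_cy = SF + B + SS7 + (12 nonnegative products)` with
* `SF` = Gladkov's THREE-PETAL SUNFLOWER inequality (BLMS 2024 Thm 2.1, tree `prodBernoulli_strongHarris_sunflower_three`) for the increasing events
  `E₁ = {a↔c} ∪ A`, `E₂ = {a↔b} ∪ A`, `E₃ = {a↔y} ∪ V`, core `A = U ∩ V`, `U = {a↔b}∪{a↔c}∪{a↔y}`, `V = {b↔c}∪{b↔y}∪{c↔y}`; in cells (`sunflower_ports_cells`):
  `c₅c₆ + (c₅+c₆)(c₁+c₂+c₃+c₄+c₇) ≤ c₀(c₈+c₉+c₁₀+c₁₁+c₁₂+c₁₃+c₁₄)`;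
* `B` = the type-B exchange inequality of `prim-bnk-1` (`FourPointExchange.typeB_cell`) for the relabelled quadruple `(y,b,a,c)`: `c₂c₆ ≤ c₀c₁₂`;
* `SS7` = the single-source law (`SingleSourceLaw.pack_singleSource`, `prim-l12-p6` gen 24) for the relabelled quadruple `(y,b,a,c)`:
  `c₂c₁₃ + c₄c₁₃ + c₈c₉ + c₉c₁₁ + c₂c₁₁ + c₂c₅ + c₅c₁₁ ≤ c₀(c₉+c₁₄)`.
A private relabelling dictionary (cells of `(y,b,a,c)` in the cells of `(a,b,c,y)`) is included.  No sorries, no named facts, no definitions, standard axioms.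
-/

noncomputable section

namespace Summit.CriticalPhenomena.PercolationContinuityZ3.Theorems

namespace ConjWPort

open MeasureTheory Set Literature.Probability.LatticeModels Literature.Probability.Percolation
open FourPointAtoms
open Summit.CriticalPhenomena.PercolationContinuityZ3.Cruxes.AdditiveGluing.TieLine.ConnAtoms
open scoped Classical

variable {n : ℕ}

/-! ### The relabelled quadruple `(y, b, a, c)` -/

/-- The atoms of the relabelled quadruple `(y b a c)` as pattern events of `(a,b,c,y)`. [this work] -/
private theorem hasPattern_atom_ybac (a b c y : Fin n) (π₀ : Fin 4 → Fin 4) :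
    HasPattern (quad a b c y) (atom (quad y b a c) π₀)
      (fun π => ∀ j k : Fin 4, π ((![3, 1, 0, 2] : Fin 4 → Fin 4) j) = π ((![3, 1, 0, 2] : Fin 4 → Fin 4) k) ↔ π₀ j = π₀ k) := by
  intro π _ ω hω
  simp only [mem_atom]
  have hq : ∀ j : Fin 4, quad y b a c j = quad a b c y ((![3, 1, 0, 2] : Fin 4 → Fin 4) j) := by
    intro j; fin_cases j <;> rfl
  constructor
  · intro h j k; rw [← hω, ← hq, ← hq]; exact h j k
  · intro h j k; rw [hq, hq, hω]; exact h j k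

/-- Cells of the relabelled quadruple `(y b a c)` in the cells of `(a,b,c,y)`. [this work] -/
private theorem cell_relabel_ybac (w : Sym2 (Fin n) → unitInterval) (a b c y : Fin n) (i : Fin 15) :
    cell w y b a c i =
      (if (∀ j k : Fin 4, pat4 0 ((![3, 1, 0, 2] : Fin 4 → Fin 4) j) = pat4 0 ((![3, 1, 0, 2] : Fin 4 → Fin 4) k) ↔ pat4 i j = pat4 i k) then cell w a b c y 0 else 0) +
      (if (∀ j k : Fin 4, pat4 1 ((![3, 1, 0, 2] : Fin 4 → Fin 4) j) = pat4 1 ((![3, 1, 0, 2] : Fin 4 → Fin 4) k) ↔ pat4 i j = pat4 i k) then cell w a b c y 1 else 0) +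
      (if (∀ j k : Fin 4, pat4 2 ((![3, 1, 0, 2] : Fin 4 → Fin 4) j) = pat4 2 ((![3, 1, 0, 2] : Fin 4 → Fin 4) k) ↔ pat4 i j = pat4 i k) then cell w a b c y 2 else 0) +
      (if (∀ j k : Fin 4, pat4 3 ((![3, 1, 0, 2] : Fin 4 → Fin 4) j) = pat4 3 ((![3, 1, 0, 2] : Fin 4 → Fin 4) k) ↔ pat4 i j = pat4 i k) then cell w a b c y 3 else 0) +
      (if (∀ j k : Fin 4, pat4 4 ((![3, 1, 0, 2] : Fin 4 → Fin 4) j) = pat4 4 ((![3, 1, 0, 2] : Fin 4 → Fin 4) k) ↔ pat4 i j = pat4 i k) then cell w a b c y 4 else 0) +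
      (if (∀ j k : Fin 4, pat4 5 ((![3, 1, 0, 2] : Fin 4 → Fin 4) j) = pat4 5 ((![3, 1, 0, 2] : Fin 4 → Fin 4) k) ↔ pat4 i j = pat4 i k) then cell w a b c y 5 else 0) +
      (if (∀ j k : Fin 4, pat4 6 ((![3, 1, 0, 2] : Fin 4 → Fin 4) j) = pat4 6 ((![3, 1, 0, 2] : Fin 4 → Fin 4) k) ↔ pat4 i j = pat4 i k) then cell w a b c y 6 else 0) +
      (if (∀ j k : Fin 4, pat4 7 ((![3, 1, 0, 2] : Fin 4 → Fin 4) j) = pat4 7 ((![3, 1, 0, 2] : Fin 4 → Fin 4) k) ↔ pat4 i j = pat4 i k) then cell w a b c y 7 else 0) +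
      (if (∀ j k : Fin 4, pat4 8 ((![3, 1, 0, 2] : Fin 4 → Fin 4) j) = pat4 8 ((![3, 1, 0, 2] : Fin 4 → Fin 4) k) ↔ pat4 i j = pat4 i k) then cell w a b c y 8 else 0) +
      (if (∀ j k : Fin 4, pat4 9 ((![3, 1, 0, 2] : Fin 4 → Fin 4) j) = pat4 9 ((![3, 1, 0, 2] : Fin 4 → Fin 4) k) ↔ pat4 i j = pat4 i k) then cell w a b c y 9 else 0) +
      (if (∀ j k : Fin 4, pat4 10 ((![3, 1, 0, 2] : Fin 4 → Fin 4) j) = pat4 10 ((![3, 1, 0, 2] : Fin 4 → Fin 4) k) ↔ pat4 i j = pat4 i k) then cell w a b c y 10 else 0) +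
      (if (∀ j k : Fin 4, pat4 11 ((![3, 1, 0, 2] : Fin 4 → Fin 4) j) = pat4 11 ((![3, 1, 0, 2] : Fin 4 → Fin 4) k) ↔ pat4 i j = pat4 i k) then cell w a b c y 11 else 0) +
      (if (∀ j k : Fin 4, pat4 12 ((![3, 1, 0, 2] : Fin 4 → Fin 4) j) = pat4 12 ((![3, 1, 0, 2] : Fin 4 → Fin 4) k) ↔ pat4 i j = pat4 i k) then cell w a b c y 12 else 0) +
      (if (∀ j k : Fin 4, pat4 13 ((![3, 1, 0, 2] : Fin 4 → Fin 4) j) = pat4 13 ((![3, 1, 0, 2] : Fin 4 → Fin 4) k) ↔ pat4 i j = pat4 i k) then cell w a b c y 13 else 0) +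
      (if (∀ j k : Fin 4, pat4 14 ((![3, 1, 0, 2] : Fin 4 → Fin 4) j) = pat4 14 ((![3, 1, 0, 2] : Fin 4 → Fin 4) k) ↔ pat4 i j = pat4 i k) then cell w a b c y 14 else 0) := by
  unfold cell
  rw [measureReal_eq_cellSum w a b c y (hasPattern_atom_ybac a b c y (pat4 i))]
  rfl

/-! ### The three-petal sunflower at the ports -/

/-- Transitivity of `↔` (membership in `openConn`). [folklore] -/
private theorem rtrans {ω : BondConfig (Fin n)} {x z v : Fin n} (h₁ : ω ∈ openConn x z) (h₂ : ω ∈ openConn z v) :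
    ω ∈ openConn x v := SimpleGraph.Reachable.trans h₁ h₂

/-- Symmetry of `↔` (membership in `openConn`). [folklore] -/
private theorem rsymm {ω : BondConfig (Fin n)} {x z : Fin n} (h : ω ∈ openConn x z) : ω ∈ openConn z x :=
  SimpleGraph.Reachable.symm h

/-- **Gladkov's three-petal sunflower inequality at the ports of `a`** (core `A` = "`a` joined to a terminal and two of `b,c,y` joined",
petals `{ac|b|y}`, `{ab|c|y}`, `{a|b|cy, a|by|c, a|bc|y, ay|b|c, a|bcy}`, outside `= {a|b|c|y}`), in cells:
`c₅c₆ + c₅(c₁+c₂+c₃+c₄+c₇) + c₆(c₁+c₂+c₃+c₄+c₇) ≤ (c₈+c₉+c₁₀+c₁₁+c₁₂+c₁₃+c₁₄)·c₀`. [cite: Gladkov2024StrongFKG, Thm. 2.1] -/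
theorem sunflower_ports_cells (w : Sym2 (Fin n) → unitInterval) (a b c y : Fin n) :
    cell w a b c y 5 * cell w a b c y 6 + cell w a b c y 5 * (cell w a b c y 1 + cell w a b c y 2 + cell w a b c y 3 + cell w a b c y 4 + cell w a b c y 7) + cell w a b c y 6 * (cell w a b c y 1 + cell w a b c y 2 + cell w a b c y 3 + cell w a b c y 4 + cell w a b c y 7) ≤
      (cell w a b c y 8 + cell w a b c y 9 + cell w a b c y 10 + cell w a b c y 11 + cell w a b c y 12 + cell w a b c y 13 + cell w a b c y 14) * cell w a b c y 0 := by
  -- the increasing events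
  set U : Set (BondConfig (Fin n)) := openConn a b ∪ openConn a c ∪ openConn a y with hUdef
  set V : Set (BondConfig (Fin n)) := openConn b c ∪ openConn b y ∪ openConn c y with hVdef
  set A : Set (BondConfig (Fin n)) := U ∩ V with hAdef
  set E₁ : Set (BondConfig (Fin n)) := openConn a c ∪ A with hE₁
  set E₂ : Set (BondConfig (Fin n)) := openConn a b ∪ A with hE₂
  set E₃ : Set (BondConfig (Fin n)) := openConn a y ∪ V with hE₃
  have hU : IsUpperSet U := ((isUpperSet_openConn a b).union (isUpperSet_openConn a c)).union (isUpperSet_openConn a y)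
  have hV : IsUpperSet V := ((isUpperSet_openConn b c).union (isUpperSet_openConn b y)).union (isUpperSet_openConn c y)
  have hA : IsUpperSet A := hU.inter hV
  have h₁ : IsUpperSet E₁ := (isUpperSet_openConn a c).union hA
  have h₂ : IsUpperSet E₂ := (isUpperSet_openConn a b).union hA
  have h₃ : IsUpperSet E₃ := (isUpperSet_openConn a y).union hV
  -- the core
  have h12 : E₁ ∩ E₂ = A := by
    ext ω
    simp only [hE₁, hE₂, hAdef, hUdef, hVdef, mem_inter_iff, mem_union]
    constructor
    · rintro ⟨hac | hA1, hab | hA2⟩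
      · exact ⟨Or.inl (Or.inl hab), Or.inl (Or.inl (rtrans (rsymm hab) hac))⟩
      · exact hA2
      · exact hA1
      · exact hA1
    · intro h; exact ⟨Or.inr h, Or.inr h⟩
  have h13 : E₁ ∩ E₃ = A := by
    ext ω
    simp only [hE₁, hE₃, hAdef, hUdef, hVdef, mem_inter_iff, mem_union]
    constructor
    · rintro ⟨hac | hA1, hay | hV3⟩
      · exact ⟨Or.inl (Or.inr hac), Or.inr (rtrans (rsymm hac) hay)⟩
      · exact ⟨Or.inl (Or.inr hac), hV3⟩
      · exact hA1
      · exact hA1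
    · intro h; exact ⟨Or.inr h, Or.inr h.2⟩
  have h23 : E₂ ∩ E₃ = A := by
    ext ω
    simp only [hE₂, hE₃, hAdef, hUdef, hVdef, mem_inter_iff, mem_union]
    constructor
    · rintro ⟨hab | hA1, hay | hV3⟩
      · exact ⟨Or.inl (Or.inl hab), Or.inl (Or.inr (rtrans (rsymm hab) hay))⟩
      · exact ⟨Or.inl (Or.inl hab), hV3⟩
      · exact hA1
      · exact hA1
    · intro h; exact ⟨Or.inr h, Or.inr h.2⟩
  have hsf := prodBernoulli_strongHarris_sunflower_three w h₁ h₂ h₃ h12 h13 h23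
  -- patterns of the events
  have pU : HasPattern (quad a b c y) U (fun π => (π 0 = π 1 ∨ π 0 = π 2) ∨ π 0 = π 3) :=
    ((oc a b c y 0 1 rfl rfl).union (oc a b c y 0 2 rfl rfl)).union (oc a b c y 0 3 rfl rfl)
  have pV : HasPattern (quad a b c y) V (fun π => (π 1 = π 2 ∨ π 1 = π 3) ∨ π 2 = π 3) :=
    ((oc a b c y 1 2 rfl rfl).union (oc a b c y 1 3 rfl rfl)).union (oc a b c y 2 3 rfl rfl)
  have pA : HasPattern (quad a b c y) A (fun π => ((π 0 = π 1 ∨ π 0 = π 2) ∨ π 0 = π 3) ∧ ((π 1 = π 2 ∨ π 1 = π 3) ∨ π 2 = π 3)) :=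
    pU.inter pV
  have pE₁ : HasPattern (quad a b c y) E₁
      (fun π => π 0 = π 2 ∨ ((π 0 = π 1 ∨ π 0 = π 2) ∨ π 0 = π 3) ∧ ((π 1 = π 2 ∨ π 1 = π 3) ∨ π 2 = π 3)) :=
    (oc a b c y 0 2 rfl rfl).union pA
  have pE₂ : HasPattern (quad a b c y) E₂
      (fun π => π 0 = π 1 ∨ ((π 0 = π 1 ∨ π 0 = π 2) ∨ π 0 = π 3) ∧ ((π 1 = π 2 ∨ π 1 = π 3) ∨ π 2 = π 3)) :=
    (oc a b c y 0 1 rfl rfl).union pA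
  have pE₃ : HasPattern (quad a b c y) E₃ (fun π => π 0 = π 3 ∨ (π 1 = π 2 ∨ π 1 = π 3) ∨ π 2 = π 3) :=
    (oc a b c y 0 3 rfl rfl).union pV
  have e1 : (prodBernoulli w).real (E₁ \ A) = cell w a b c y 5 := by
    rw [measureReal_eq_cellSum w a b c y (pE₁.diff pA)]
    simp (config := {decide := true}) only [ite_true, ite_false]; ring
  have e2 : (prodBernoulli w).real (E₂ \ A) = cell w a b c y 6 := by
    rw [measureReal_eq_cellSum w a b c y (pE₂.diff pA)]
    simp (config := {decide := true}) only [ite_true, ite_false]; ring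
  have e3 : (prodBernoulli w).real (E₃ \ A) = cell w a b c y 1 + cell w a b c y 2 + cell w a b c y 3 + cell w a b c y 4 + cell w a b c y 7 := by
    rw [measureReal_eq_cellSum w a b c y (pE₃.diff pA)]
    simp (config := {decide := true}) only [ite_true, ite_false]; ring
  have eA : (prodBernoulli w).real A = cell w a b c y 8 + cell w a b c y 9 + cell w a b c y 10 + cell w a b c y 11 + cell w a b c y 12 + cell w a b c y 13 + cell w a b c y 14 := by
    rw [measureReal_eq_cellSum w a b c y pA]
    simp (config := {decide := true}) only [ite_true, ite_false]; ring
  have eB : (prodBernoulli w).real (E₁ ∪ E₂ ∪ E₃)ᶜ = cell w a b c y 0 := by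
    rw [measureReal_eq_cellSum w a b c y ((pE₁.union pE₂).union pE₃).compl]
    simp (config := {decide := true}) only [ite_true, ite_false]; ring
  rw [e1, e2, e3, eA, eB] at hsf
  linarith [hsf]

/-! ### The row `R_cy` -/

/-- **The port row `R_cy` of the three-port transfer** (memo §2; = the criterion combination `C_qx + C_cy ≥ 0`), on every finite weighted graph:
`(c₅+c₆)(c₁+2c₂+c₃+c₇) + c₂c₁₃ ≤ 2c₀(c₄+c₈+c₉+c₁₀+c₁₁+c₁₂+c₁₄) + c₀c₁₃` — a necessary consequence of Conjecture W (limit over the SK3-tight path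
`c–b–y`), here PROVED: sunflower + type B + single-source law + nonnegative products. [this work] -/
theorem portRow_cy_cells (w : Sym2 (Fin n) → unitInterval) (a b c y : Fin n) :
    (cell w a b c y 5 + cell w a b c y 6) * (cell w a b c y 1 + 2 * cell w a b c y 2 + cell w a b c y 3 + cell w a b c y 7) + cell w a b c y 2 * cell w a b c y 13 ≤
      2 * (cell w a b c y 0 * (cell w a b c y 4 + cell w a b c y 8 + cell w a b c y 9 + cell w a b c y 10 + cell w a b c y 11 + cell w a b c y 12 + cell w a b c y 14)) + cell w a b c y 0 * cell w a b c y 13 := by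
  have hSF := sunflower_ports_cells w a b c y
  -- type B and the single-source law on the relabelled quadruple (y,b,a,c)
  have hB := FourPointExchange.typeB_cell w y b a c
  have hS := SingleSourceLaw.pack_singleSource w y b a c
  have r0 := cell_relabel_ybac w a b c y 0; have r1 := cell_relabel_ybac w a b c y 1
  have r3 := cell_relabel_ybac w a b c y 3; have r5 := cell_relabel_ybac w a b c y 5
  have r6 := cell_relabel_ybac w a b c y 6; have r7 := cell_relabel_ybac w a b c y 7
  have r8 := cell_relabel_ybac w a b c y 8; have r9 := cell_relabel_ybac w a b c y 9
  have r11 := cell_relabel_ybac w a b c y 11; have r13 := cell_relabel_ybac w a b c y 13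
  have r14 := cell_relabel_ybac w a b c y 14
  simp (config := {decide := true}) only [ite_true, ite_false, add_zero, zero_add] at r0 r1 r3 r5 r6 r7 r8 r9 r11 r13 r14
  rw [r0, r3, r6, r13] at hB
  rw [r0, r1, r5, r6, r7, r8, r9, r11, r14] at hS
  have h0 := cell_nonneg w a b c y 0; have h2 := cell_nonneg w a b c y 2; have h4 := cell_nonneg w a b c y 4
  have h5 := cell_nonneg w a b c y 5; have h6 := cell_nonneg w a b c y 6; have h8 := cell_nonneg w a b c y 8
  have h9 := cell_nonneg w a b c y 9; have h10 := cell_nonneg w a b c y 10; have h11 := cell_nonneg w a b c y 11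
  have h13 := cell_nonneg w a b c y 13
  have m04 := mul_nonneg h0 h4; have m08 := mul_nonneg h0 h8; have m010 := mul_nonneg h0 h10; have m011 := mul_nonneg h0 h11
  have m211 := mul_nonneg h2 h11; have m45 := mul_nonneg h4 h5; have m46 := mul_nonneg h4 h6; have m413 := mul_nonneg h4 h13
  have m56 := mul_nonneg h5 h6; have m511 := mul_nonneg h5 h11; have m89 := mul_nonneg h8 h9; have m911 := mul_nonneg h9 h11
  linarith [hSF, hB, hS, m04, m08, m010, m011, m211, m45, m46, m413, m56, m511, m89, m911]

end ConjWPort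

end Summit.CriticalPhenomena.PercolationContinuityZ3.Theorems
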